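import Literature.Computability.LopesEtAl2021.Refinement

/-!
# Alive (PLDI 2015): the correctness criteria of a peephole transformation, and Tables 1–2

Source followed verbatim: N. P. Lopes, D. Menendez, S. Nagarakatte, J. Regehr, *Provably Correct Peephole
Optimizations with Alive*, PLDI 2015 [LopesEtAl2015], §2.4 (Tables 1 and 2: definedness and poison-free
constraints of the arithmetic instructions), §3.1 (correctness = refinement; the three informal checks),
§3.1.1 (per instruction the VC Gen computes a value, a definedness and a poison-free expression) and §3.1.2
"Correctness Criteria" (the three displayed validity conditions with their quantifier prefix over `undef`
variables).

Printed (§3.1.2, p. 5): "Let φ be the precondition of a transformation, δ be the definedness constraint of the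
source instruction, ρ be the poison-free constraint, ι the result of executing a source instruction, and δ̄, ρ̄, and ῑ
the respective constraints for the target.  Let I be the set of input variables from the source template including
constants, P be the set of all fresh variables p used to encode approximating analyses in the precondition, and U
and Ū be the sets of variables created by the VC Gen to encode undef values of the source and target, respectively.
Let ψ ≡ φ ∧ δ ∧ ρ.  A transformation specified in Alive is correct iff all of the following constraints hold for each
instruction:  1. ∀I,P,Ū ∃U : ψ ⟹ δ̄   2. ∀I,P,Ū ∃U : ψ ⟹ ρ̄   3. ∀I,P,Ū ∃U : ψ ⟹ ι = ῑ.  […] To check validity, we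
check if the negation of the above formulas are unsatisfiable […].  The first constraint states that the target
operation should be defined whenever the source operation is defined.  The second constraint states that the target
operation can only produce poison values for the inputs that the source operation does.  Finally, the third
constraint states that the source and target instructions should produce the same result whenever the precondition
holds and the source operation is defined and poison-free."
Printed (§3.1, p. 4): "we check correctness by checking (1) the target is defined when the source is defined, (2)
the target is poison-free when the source is poison-free, and (3) the source and the target produce the same result
when the source is defined and poison-free."
Printed (§2.4, p. 4): "Poison values […] are used to indicate that a side-effect-free instruction has a condition
that produces undefined behavior.  When the poison value gets used by an instruction with side effects, the program
exhibits true undefined behavior.  Hence, poison values are deferred undefined behaviors".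

## What is formalised
* `InstrVC I U U' α`: the seven per-instruction expressions over an input valuation `i : I` (inputs, constants and
  the fresh variables `P`, all universally quantified), a source undef valuation `u : U` and a target one `u' : U'`;
  `ψ`, the three conditions `Cond1`–`Cond3` with the printed prefix `∀ i u', ∃ u`, and `Correct` (§3.1.2 verbatim);
  for undef-free instructions (`U = U' = Unit`) the unsat form `correct_iff_unsat` ("we check if (1) ψ ∧ ¬δ̄, (2)
  ψ ∧ ¬ρ̄, and (3) ψ ∧ ι ≠ ῑ are unsat") and the unfolded form `correct_iff`.
* The §3.1 prose checks (1)–(3) as `ProseCorrect`, and the instruction's behaviour as an Alive2 final state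
  (`outcome`: UB / poison / value — the vocabulary of `Literature.Computability.LopesEtAl2021`), with
  **`proseCorrect_iff_refines`**: for an undef-free, memory-free instruction the prose checks ARE Alive2's
  final-state refinement `⊒st` (PLDI 2021 Fig. 4) under the precondition.
* The relation between the displayed formulas and the prose, proved not asserted: `ProseCorrect → Correct`
  (`proseCorrect_imp_correct`); `Correct ↔ ProseCorrect` restricted to inputs where the source is not poison, i.e.
  **`proseCorrect_iff_correct_and`**: the displayed `ψ ≡ φ ∧ δ ∧ ρ` puts the poison-free constraint in the
  hypothesis of condition 1 as well, so the formulas allow the TARGET TO BE UNDEFINED where the SOURCE IS POISON —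
  consistent with the paper's 2015 reading of poison as "deferred undefined behavior" (§2.4 quoted above;
  `Correct ↔` refinement for the order in which poison sits with UB at the top, `correct_iff_refinesDeferredUB`),
  and NOT a refinement for Alive2's value-poison (`correct_not_imp_proseCorrect`: a one-line instance).  This is the
  precise sense in which a rule "verified by Alive (2015)" carries a weaker guarantee than Alive2 refinement.
* Tables 1 and 2 verbatim as predicates on `BitVec B` (`Table1.sdiv … ashr`, `Table2.addNsw … lshrExact`), with
  `decide`d instances at small width, and the §2.4 example `add nsw %x, 1; icmp sgt %1, %x ⇒ true` as a `Correct`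
  instruction VC at width 4.
## What is not
Theorem 1 ("Soundness: if conditions 1–3 hold for every instruction […] and for any valid type assignment […] then
the transformation is correct") concerns the VC Gen's aggregation of definedness / poison-free constraints along
def-use chains and the enumeration of feasible types (§3.1.1, §3.2); it is an implementation theorem and is not
transcribed — for a single instruction it is the definition below.  Memory (§3.3), `undef` SEMANTICS of individual
instructions (Fig. 4) and the predicate language (§2.3) are not here either.
-/

namespace Literature.Computability.LopesEtAl2015

open Literature.Computability.LopesEtAl2021

/-! ## §3.1.1–§3.1.2: per-instruction verification conditions and the correctness criteria -/

/-- The per-instruction expressions of the VC Gen (§3.1.1: "For each instruction, Alive computes three SMT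
expressions: (1) an expression for the result of the operation […], (2) an expression representing the cases for
which the instruction has defined behavior, and (3) an expression representing the cases for which the instruction
does not return a poison value"), for the source (`δ`, `ρ`, `ι`) and the target (`δ'`, `ρ'`, `ι'` — the paper's
`δ̄`, `ρ̄`, `ῑ`), together with the precondition `φ`.  They are functions of the valuation `i : I` of the input
variables, constants and fresh analysis variables `P` (all universally quantified in §3.1.2, so merged here), of
the source's undef variables `u : U` and of the target's `u' : U'`. [cite: LopesEtAl2015, §3.1.1 and §3.1.2] -/
structure InstrVC (I U U' α : Type*) where
  /-- precondition `φ` of the transformation -/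
  φ : I → Prop
  /-- definedness constraint `δ` of the source instruction -/
  δ : I → U → Prop
  /-- poison-free constraint `ρ` of the source instruction -/
  ρ : I → U → Prop
  /-- result `ι` of the source instruction -/
  ι : I → U → α
  /-- definedness constraint `δ̄` of the target instruction -/
  δ' : I → U' → Prop
  /-- poison-free constraint `ρ̄` of the target instruction -/
  ρ' : I → U' → Prop
  /-- result `ῑ` of the target instruction -/
  ι' : I → U' → α

namespace InstrVC

variable {I U U' α : Type*}

/-- `ψ ≡ φ ∧ δ ∧ ρ`. [cite: LopesEtAl2015, §3.1.2] -/
def ψ (c : InstrVC I U U' α) (i : I) (u : U) : Prop := c.φ i ∧ c.δ i u ∧ c.ρ i u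

/-- Condition 1: `∀I,P,Ū ∃U : ψ ⟹ δ̄` ("the target operation should be defined whenever the source operation is
defined" — formally: whenever `ψ`). [cite: LopesEtAl2015, §3.1.2] -/
def Cond1 (c : InstrVC I U U' α) : Prop := ∀ (i : I) (u' : U'), ∃ u : U, c.ψ i u → c.δ' i u'

/-- Condition 2: `∀I,P,Ū ∃U : ψ ⟹ ρ̄` ("the target operation can only produce poison values for the inputs that
the source operation does"). [cite: LopesEtAl2015, §3.1.2] -/
def Cond2 (c : InstrVC I U U' α) : Prop := ∀ (i : I) (u' : U'), ∃ u : U, c.ψ i u → c.ρ' i u'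

/-- Condition 3: `∀I,P,Ū ∃U : ψ ⟹ ι = ῑ` ("the source and target instructions should produce the same result
whenever the precondition holds and the source operation is defined and poison-free"; universal over the target's
undef values, existential over the source's, "which occurs after the universal quantifier").
[cite: LopesEtAl2015, §3.1.2] -/
def Cond3 (c : InstrVC I U U' α) : Prop := ∀ (i : I) (u' : U'), ∃ u : U, c.ψ i u → c.ι i u = c.ι' i u'

/-- "A transformation specified in Alive is correct iff all of the following constraints hold for each
instruction: 1. […] 2. […] 3. […]" — per instruction. [cite: LopesEtAl2015, §3.1.2] -/
def Correct (c : InstrVC I U U' α) : Prop := c.Cond1 ∧ c.Cond2 ∧ c.Cond3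

/-! ### Undef-free instructions (`U = Ū = ∅` in the paper: no quantifier; here `Unit`) -/

/-- Without undef variables, conditions 1–3 read `ψ ⟹ δ̄`, `ψ ⟹ ρ̄`, `ψ ⟹ ι = ῑ` for every input valuation.
[cite: LopesEtAl2015, §3.1.2] -/
theorem correct_iff (c : InstrVC I Unit Unit α) :
    c.Correct ↔ ∀ i, c.φ i → c.δ i () → c.ρ i () → (c.δ' i () ∧ c.ρ' i () ∧ c.ι i () = c.ι' i ()) := by
  constructor
  · rintro ⟨h1, h2, h3⟩ i hφ hδ hρ
    obtain ⟨⟨⟩, hu1⟩ := h1 i ()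
    obtain ⟨⟨⟩, hu2⟩ := h2 i ()
    obtain ⟨⟨⟩, hu3⟩ := h3 i ()
    exact ⟨hu1 ⟨hφ, hδ, hρ⟩, hu2 ⟨hφ, hδ, hρ⟩, hu3 ⟨hφ, hδ, hρ⟩⟩
  · intro h
    refine ⟨fun i u' => ⟨(), fun hψ => ?_⟩, fun i u' => ⟨(), fun hψ => ?_⟩, fun i u' => ⟨(), fun hψ => ?_⟩⟩
    · exact (h i hψ.1 hψ.2.1 hψ.2.2).1
    · exact (h i hψ.1 hψ.2.1 hψ.2.2).2.1
    · exact (h i hψ.1 hψ.2.1 hψ.2.2).2.2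

/-- "To check validity, we check if the negation of the above formulas are unsatisfiable; that is, we check if
(1) […] ψ ∧ ¬δ̄, (2) […] ψ ∧ ¬ρ̄, and (3) […] ψ ∧ ι ≠ ῑ are unsat." [cite: LopesEtAl2015, §3.1.2] -/
theorem correct_iff_unsat (c : InstrVC I Unit Unit α) :
    c.Correct ↔ (¬ ∃ i, c.ψ i () ∧ ¬ c.δ' i ()) ∧ (¬ ∃ i, c.ψ i () ∧ ¬ c.ρ' i ()) ∧
      (¬ ∃ i, c.ψ i () ∧ c.ι i () ≠ c.ι' i ()) := by
  rw [correct_iff]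
  simp only [not_exists, not_and, not_not, ne_eq]
  constructor
  · intro h
    exact ⟨fun i hψ => (h i hψ.1 hψ.2.1 hψ.2.2).1, fun i hψ => (h i hψ.1 hψ.2.1 hψ.2.2).2.1,
      fun i hψ => (h i hψ.1 hψ.2.1 hψ.2.2).2.2⟩
  · rintro ⟨h1, h2, h3⟩ i hφ hδ hρ
    exact ⟨h1 i ⟨hφ, hδ, hρ⟩, h2 i ⟨hφ, hδ, hρ⟩, h3 i ⟨hφ, hδ, hρ⟩⟩

/-! ## §3.1: the instruction's behaviour and the three prose checks -/

open Classical in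
/-- The behaviour of a (deterministic, memory-free) instruction with definedness `δ`, poison-freeness `ρ` and
result `v`, as an Alive2 final state: undefined behaviour if `¬δ`; otherwise `poison` if `¬ρ`; otherwise the
well-defined value `v` (§2.4: UB "anything may happen"; poison "taint[s] subsequent dependent instructions").
[cite: LopesEtAl2015, §2.4 and §3.1.1] -/
noncomputable def outcome (δ ρ : Prop) (v : α) : FinalState α :=
  if δ then (if ρ then ⟨Val.defined v, false⟩ else ⟨Val.poison, false⟩) else ⟨Val.poison, true⟩

/-- The source instruction's behaviour on input valuation `i`. [cite: LopesEtAl2015, §3.1] -/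
noncomputable def srcOutcome (c : InstrVC I Unit Unit α) (i : I) : FinalState α :=
  outcome (c.δ i ()) (c.ρ i ()) (c.ι i ())

/-- The target instruction's behaviour on input valuation `i`. [cite: LopesEtAl2015, §3.1] -/
noncomputable def tgtOutcome (c : InstrVC I Unit Unit α) (i : I) : FinalState α :=
  outcome (c.δ' i ()) (c.ρ' i ()) (c.ι' i ())

/-- The three checks of §3.1 as printed in prose, under the precondition: "(1) the target is defined when the
source is defined, (2) the target is poison-free when the source is poison-free, and (3) the source and the target
produce the same result when the source is defined and poison-free" ((2) and (3) for a defined source — an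
undefined source allows every target behaviour, §2.4). [cite: LopesEtAl2015, §3.1] -/
def ProseCorrect (c : InstrVC I Unit Unit α) : Prop :=
  ∀ i, c.φ i →
    (c.δ i () → c.δ' i ()) ∧ (c.δ i () → c.ρ i () → c.ρ' i ()) ∧ (c.δ i () → c.ρ i () → c.ι i () = c.ι' i ())

/-- **The prose checks (1)–(3) are Alive2's final-state refinement** (PLDI 2021, Fig. 4: final-state-ub,
final-state, value-poison, element-nonptr) of the target behaviour by the source behaviour, for every input
satisfying the precondition. [cite: LopesEtAl2015, §3.1; LopesEtAl2021, Figure 4] -/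
theorem proseCorrect_iff_refines (c : InstrVC I Unit Unit α) :
    c.ProseCorrect ↔ ∀ i, c.φ i → FinalState.Refines (c.srcOutcome i) (c.tgtOutcome i) := by
  refine forall₂_congr fun i _ => ?_
  simp only [srcOutcome, tgtOutcome, outcome]
  by_cases hδ : c.δ i () <;> by_cases hρ : c.ρ i () <;> by_cases hδ' : c.δ' i () <;>
    by_cases hρ' : c.ρ' i () <;> simp [hδ, hρ, hδ', hρ', FinalState.Refines, Val.defined, Val.Refines]
  exact eq_comm

/-- The prose checks imply the displayed conditions 1–3. [cite: LopesEtAl2015, §3.1 and §3.1.2] -/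
theorem proseCorrect_imp_correct (c : InstrVC I Unit Unit α) (h : c.ProseCorrect) : c.Correct := by
  rw [correct_iff]
  intro i hφ hδ hρ
  obtain ⟨h1, h2, h3⟩ := h i hφ
  exact ⟨h1 hδ, h2 hδ hρ, h3 hδ hρ⟩

/-- **Displayed formulas vs. prose.**  Since the displayed `ψ ≡ φ ∧ δ ∧ ρ` carries the poison-free constraint
into the hypothesis of condition 1 too, conditions 1–3 are the prose checks EXCEPT on inputs where the source is
defined but poison: there the formulas impose nothing, the prose check (1) still asks the target to be defined.
[cite: LopesEtAl2015, §3.1 and §3.1.2] -/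
theorem proseCorrect_iff_correct_and (c : InstrVC I Unit Unit α) :
    c.ProseCorrect ↔ c.Correct ∧ ∀ i, c.φ i → c.δ i () → ¬ c.ρ i () → c.δ' i () := by
  rw [correct_iff]
  constructor
  · intro h
    exact ⟨fun i hφ hδ hρ => let ⟨h1, h2, h3⟩ := h i hφ; ⟨h1 hδ, h2 hδ hρ, h3 hδ hρ⟩,
      fun i hφ hδ _ => (h i hφ).1 hδ⟩
  · rintro ⟨h, h'⟩ i hφ
    refine ⟨fun hδ => ?_, fun hδ hρ => (h i hφ hδ hρ).2.1, fun hδ hρ => (h i hφ hδ hρ).2.2⟩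
    by_cases hρ : c.ρ i ()
    · exact (h i hφ hδ hρ).1
    · exact h' i hφ hδ hρ

/-- The order in which the displayed formulas ARE refinement: poison "deferred undefined behavior" (§2.4) sits
with UB at the top — a source whose result is poison, like an undefined source, is refined by every target
behaviour; otherwise as in Alive2. [cite: LopesEtAl2015, §2.4 and §3.1.2] -/
def RefinesDeferredUB (s t : FinalState α) : Prop :=
  s.ub = true ∨ s.ret = Val.poison ∨ (t.ub = false ∧ Val.Refines s.ret t.ret)

/-- Alive2's final-state refinement implies the deferred-UB reading (the latter is weaker).
[cite: LopesEtAl2015, §2.4; LopesEtAl2021, Figure 4] -/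
theorem refinesDeferredUB_of_refines {s t : FinalState α} (h : FinalState.Refines s t) :
    RefinesDeferredUB s t := by
  rcases h with h | h
  · exact Or.inl h
  · exact Or.inr (Or.inr h)

/-- **Conditions 1–3 (undef-free) are exactly refinement in the deferred-UB order** under the precondition.
[cite: LopesEtAl2015, §2.4 and §3.1.2] -/
theorem correct_iff_refinesDeferredUB (c : InstrVC I Unit Unit α) :
    c.Correct ↔ ∀ i, c.φ i → RefinesDeferredUB (c.srcOutcome i) (c.tgtOutcome i) := by
  rw [correct_iff]
  refine forall₂_congr fun i _ => ?_
  simp only [srcOutcome, tgtOutcome, outcome, RefinesDeferredUB]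
  by_cases hδ : c.δ i () <;> by_cases hρ : c.ρ i () <;> by_cases hδ' : c.δ' i () <;>
    by_cases hρ' : c.ρ' i () <;> simp [hδ, hρ, hδ', hρ', Val.defined, Val.Refines]
  exact eq_comm

/-- The gap is real: a source instruction that is always poison and a target that is always undefined satisfy
conditions 1–3 (vacuously: `ψ` is unsatisfiable) but not prose check (1) — and not Alive2 refinement
(`proseCorrect_iff_refines`). [cite: LopesEtAl2015, §3.1 and §3.1.2] -/
theorem correct_not_imp_proseCorrect :
    ∃ c : InstrVC Unit Unit Unit Unit, c.Correct ∧ ¬ c.ProseCorrect := by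
  refine ⟨⟨fun _ => True, fun _ _ => True, fun _ _ => False, fun _ _ => (), fun _ _ => False,
    fun _ _ => True, fun _ _ => ()⟩, ?_, ?_⟩
  · rw [correct_iff]; intro _ _ _ h; exact h.elim
  · intro h; exact (h () trivial).1 trivial

/-- With undef variables in the SOURCE only, the existential lets "undef […] be instantiated with any value that
enables the validity of the correctness conditions": conditions 1–3 hold as soon as they hold for SOME fixed
instantiation of the source's undef variables. [cite: LopesEtAl2015, §3.1.2] -/
theorem correct_of_instantiation (c : InstrVC I U U' α) (pick : I → U' → U)
    (h1 : ∀ i u', c.ψ i (pick i u') → c.δ' i u') (h2 : ∀ i u', c.ψ i (pick i u') → c.ρ' i u')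
    (h3 : ∀ i u', c.ψ i (pick i u') → c.ι i (pick i u') = c.ι' i u') : c.Correct :=
  ⟨fun i u' => ⟨pick i u', h1 i u'⟩, fun i u' => ⟨pick i u', h2 i u'⟩, fun i u' => ⟨pick i u', h3 i u'⟩⟩

/-- The paper's undef example (§3.1.2): `%r = select undef, i4 -1, 0 ⇒ %r = ashr undef, 3` — both sides always
defined and poison-free, `ι ≡ ite(u₁ = 1, −1, 0)`, `ῑ ≡ u₂ >> 3` (arithmetic shift); "We check the validity of
[…] ∀u₂ ∃u₁ : ι = ῑ.  Since the formula is valid, the Alive transformation is correct."  Here with the source undef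
`u₁ : BitVec 1` and the target undef `u₂ : BitVec 4`. [cite: LopesEtAl2015, §3.1.2] -/
theorem selectUndef_ashrUndef_correct :
    (⟨fun _ => True, fun _ _ => True, fun _ _ => True,
      fun _ (u₁ : BitVec 1) => (if u₁ = 1 then (-1 : BitVec 4) else 0),
      fun _ _ => True, fun _ _ => True,
      fun _ (u₂ : BitVec 4) => BitVec.sshiftRight u₂ 3⟩ : InstrVC Unit (BitVec 1) (BitVec 4) (BitVec 4)).Correct := by
  refine correct_of_instantiation _ (fun _ u₂ => if u₂.msb then 1 else 0) (fun _ _ _ => trivial)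
    (fun _ _ _ => trivial) ?_
  intro i u₂ hψ
  clear hψ
  cases i
  simp only
  revert u₂
  decide

end InstrVC

/-! ## Table 1: "The constraints for Alive's arithmetic instructions to be defined" (`B` = bit-width) -/

namespace Table1

variable {B : ℕ}

/-- `sdiv a, b`: `b ≠ 0 ∧ (a ≠ INT_MIN ∨ b ≠ −1)`. [cite: LopesEtAl2015, Table 1] -/
def sdiv (a b : BitVec B) : Prop := b ≠ 0 ∧ (a ≠ BitVec.intMin B ∨ b ≠ -1)

/-- `udiv a, b`: `b ≠ 0`. [cite: LopesEtAl2015, Table 1] -/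
def udiv (_a b : BitVec B) : Prop := b ≠ 0

/-- `srem a, b`: `b ≠ 0 ∧ (a ≠ INT_MIN ∨ b ≠ −1)`. [cite: LopesEtAl2015, Table 1] -/
def srem (a b : BitVec B) : Prop := b ≠ 0 ∧ (a ≠ BitVec.intMin B ∨ b ≠ -1)

/-- `urem a, b`: `b ≠ 0`. [cite: LopesEtAl2015, Table 1] -/
def urem (_a b : BitVec B) : Prop := b ≠ 0

/-- `shl a, b`: `b <u B` (the shift amount, an unsigned `B`-bit number, is below the width).
[cite: LopesEtAl2015, Table 1] -/
def shl (_a b : BitVec B) : Prop := b.toNat < B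

/-- `lshr a, b`: `b <u B`. [cite: LopesEtAl2015, Table 1] -/
def lshr (_a b : BitVec B) : Prop := b.toNat < B

/-- `ashr a, b`: `b <u B`. [cite: LopesEtAl2015, Table 1] -/
def ashr (_a b : BitVec B) : Prop := b.toNat < B

/-- Table 1 at width 4: `sdiv −8, −1` (INT_MIN / −1) is undefined, `sdiv −8, 2` is defined; `shl a, 4` is
undefined, `shl a, 3` defined. [cite: LopesEtAl2015, Table 1] -/
example : ¬ sdiv (BitVec.intMin 4) (-1) ∧ sdiv (BitVec.intMin 4) 2 ∧ ¬ shl (1 : BitVec 4) 4 ∧ shl (1 : BitVec 4) 3 := by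
  unfold sdiv shl; decide

end Table1

/-! ## Table 2: "The constraints for Alive's arithmetic instructions to be poison-free"

"`SExt(a, n)` sign-extends `a` by `n` bits; `ZExt(a, n)` zero-extends `a` by `n` bits"; `>>u` / `÷u` unsigned,
`>>` / `÷` signed; `B` is the bit-width of the operands. -/

namespace Table2

variable {B : ℕ}

/-- `add nsw a, b`: `SExt(a,1) + SExt(b,1) = SExt(a + b, 1)`. [cite: LopesEtAl2015, Table 2] -/
def addNsw (a b : BitVec B) : Prop :=
  a.signExtend (B + 1) + b.signExtend (B + 1) = (a + b).signExtend (B + 1)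

/-- `add nuw a, b`: `ZExt(a,1) + ZExt(b,1) = ZExt(a + b, 1)`. [cite: LopesEtAl2015, Table 2] -/
def addNuw (a b : BitVec B) : Prop :=
  a.zeroExtend (B + 1) + b.zeroExtend (B + 1) = (a + b).zeroExtend (B + 1)

/-- `sub nsw a, b`: `SExt(a,1) − SExt(b,1) = SExt(a − b, 1)`. [cite: LopesEtAl2015, Table 2] -/
def subNsw (a b : BitVec B) : Prop :=
  a.signExtend (B + 1) - b.signExtend (B + 1) = (a - b).signExtend (B + 1)

/-- `sub nuw a, b`: `ZExt(a,1) − ZExt(b,1) = ZExt(a − b, 1)`. [cite: LopesEtAl2015, Table 2] -/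
def subNuw (a b : BitVec B) : Prop :=
  a.zeroExtend (B + 1) - b.zeroExtend (B + 1) = (a - b).zeroExtend (B + 1)

/-- `mul nsw a, b`: `SExt(a,B) × SExt(b,B) = SExt(a × b, B)` (double width). [cite: LopesEtAl2015, Table 2] -/
def mulNsw (a b : BitVec B) : Prop :=
  a.signExtend (B + B) * b.signExtend (B + B) = (a * b).signExtend (B + B)

/-- `mul nuw a, b`: `ZExt(a,B) × ZExt(b,B) = ZExt(a × b, B)`. [cite: LopesEtAl2015, Table 2] -/
def mulNuw (a b : BitVec B) : Prop :=
  a.zeroExtend (B + B) * b.zeroExtend (B + B) = (a * b).zeroExtend (B + B)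

/-- `sdiv exact a, b`: `(a ÷ b) × b = a`. [cite: LopesEtAl2015, Table 2] -/
def sdivExact (a b : BitVec B) : Prop := BitVec.sdiv a b * b = a

/-- `udiv exact a, b`: `(a ÷u b) × b = a`. [cite: LopesEtAl2015, Table 2] -/
def udivExact (a b : BitVec B) : Prop := BitVec.udiv a b * b = a

/-- `shl nsw a, b`: `(a << b) >> b = a` (arithmetic shift back). [cite: LopesEtAl2015, Table 2] -/
def shlNsw (a b : BitVec B) : Prop := BitVec.sshiftRight (a <<< b) b.toNat = a

/-- `shl nuw a, b`: `(a << b) >>u b = a`. [cite: LopesEtAl2015, Table 2] -/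
def shlNuw (a b : BitVec B) : Prop := (a <<< b) >>> b = a

/-- `ashr exact a, b`: `(a >> b) << b = a`. [cite: LopesEtAl2015, Table 2] -/
def ashrExact (a b : BitVec B) : Prop := BitVec.sshiftRight a b.toNat <<< b = a

/-- `lshr exact a, b`: `(a >>u b) << b = a`. [cite: LopesEtAl2015, Table 2] -/
def lshrExact (a b : BitVec B) : Prop := (a >>> b) <<< b = a

/-- Table 2 at width 4: `add nsw 7, 1` is poison (signed overflow), `add nsw 3, 4` is not; `add nuw 15, 1` is
poison, `add nuw 7, 8` is not; `mul nsw 4, 2` is poison, `mul nuw 4, 2` is not; `shl nsw 4, 1` is poison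
(`0100 << 1 = 1000`, shifted back `1100`), `shl nuw 4, 1` is not; `udiv exact 7, 2` is poison, `lshr exact 6, 1`
is not. [cite: LopesEtAl2015, Table 2] -/
example : ¬ addNsw (7 : BitVec 4) 1 ∧ addNsw (3 : BitVec 4) 4 ∧ ¬ addNuw (15 : BitVec 4) 1 ∧ addNuw (7 : BitVec 4) 8 ∧
    ¬ mulNsw (4 : BitVec 4) 2 ∧ mulNuw (4 : BitVec 4) 2 ∧ ¬ shlNsw (4 : BitVec 4) 1 ∧ shlNuw (4 : BitVec 4) 1 ∧
    ¬ udivExact (7 : BitVec 4) 2 ∧ lshrExact (6 : BitVec 4) 1 := by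
  unfold addNsw addNuw mulNsw mulNuw shlNsw shlNuw udivExact lshrExact
  decide

end Table2

/-! ## The §2.4 example as an instruction VC: `%1 = add nsw %x, 1; %2 = icmp sgt %1, %x  ⇒  %2 = true` -/

/-- The `nsw` example of §2.4 ("equivalent to the optimization of `(x+1)>x` to `1` in C/C++ […] is valid"), for
the compared instruction `%2` at width 4: input `x`, source defined, poison-free iff `add nsw x, 1` is (Table 2;
"poison values taint subsequent dependent instructions"), value `x + 1 >s x`; target the constant `true`.
Conditions 1–3 hold (checked by `decide` over the 16 inputs). [cite: LopesEtAl2015, §2.4 and §3.1.2] -/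
theorem addNsw_icmp_sgt_correct :
    (⟨fun _ => True, fun _ _ => True, fun x _ => Table2.addNsw x (1 : BitVec 4),
      fun x _ => decide (BitVec.slt x (x + 1)), fun _ _ => True, fun _ _ => True, fun _ _ => true⟩ :
      InstrVC (BitVec 4) Unit Unit Bool).Correct := by
  rw [InstrVC.correct_iff]
  intro x _ _ hρ
  refine ⟨trivial, trivial, ?_⟩
  revert x
  unfold Table2.addNsw
  decide

end Literature.Computability.LopesEtAl2015
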